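import Literature.AlgebraicGeometry.Kawanoue2007.LeadingGeneratorSystem
import Literature.AlgebraicGeometry.Resolution.RegularLocalRingsNormal
import Literature.AlgebraicGeometry.Resolution.RsopMonomialIdeals
import Literature.AlgebraicGeometry.Resolution.StrictNormalCrossingsDescent
import Mathlib.RingTheory.MvPolynomial.Ideal
import HarnessLib

/-!
# Kawanoue 2007, Part I, §4.1.2: Supporting Lemma 3 (Lemma 4.1.2.3) — the filtration identity
# `(∑ R h_l) ∩ 𝔪^r = ∑ 𝔪^{r − p^{e_l}} h_l`, PROVED

H. Kawanoue, *Toward resolution of singularities over a field of positive characteristic. Part I.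
Foundation; the language of the idealistic filtration*, Publ. RIMS **43** (2007) 819–909
(= arXiv:math/0607009) [Kawanoue2007], Chapter 4 «§4.1. Preparation toward the nonsingularity
principle», 4.1.2 «Statements and proofs of the supporting lemmas». Pages re-read on the held arXiv text
(`lit read paper:arxiv-math-0607009`, chunks p0085–p0090; locators = chunk:line). Campaign
`res-hironaka` (D-0089), rung LIT-6, seat res-lit-2: first brick of the Chapter-4 programme sized in
`HOME/lit/res-lit-2/SIZING-IFP-Ch4.md` (Supporting Lemma 3 is used by the Coefficient Lemma 4.1.4.1,
by Thm. 4.2.1.1 = the tree's facts `Kawanoue2007_thm_4_2_1_1(_generate)`, and by Kawanoue–Matsuki 2010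
Prop. 3.1.2.1 = `KawanoueMatsuki2010_prop_3_1_2_1`, inequality (∗), «Lemma 4.1.2.3 in Part I»).
This file proves Lemma 4.1.2.3 only; Lemmas 4.1.2.1–4.1.2.2 (the differential operators `D_u`, `F_v`)
are not here. NO named fact is introduced (net debt 0). Nothing of H. Hironaka's 2017 manuscript is
referred to or asserted.

## What is printed (locators)

* Chapter setting (p0085 L17): «`R` represents the localization at a maximal ideal, or its completion, of
  the coordinate ring of an affine open subset of a variety `W` smooth over an algebraically closed field
  `k` of `char(k) = p > 0`, or characteristic zero where we formally set `p = ∞`».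
* Setting 4.1.1 (p0086 L1–L4): «Let `ℋ = {h_1, …, h_N} ⊂ R` … and let `0 ≤ e_1 ≤ ⋯ ≤ e_N` be nonnegative
  integers …: (i) `h_l ∈ 𝔪^{p^{e_l}}` and `h̄_l = (h_l mod 𝔪^{p^{e_l}+1}) ∈ F^{e_l}(G_1)` for `l = 1, …, N`.
  (ii) `{h̄_l^{p^{e_s−e_l}} ; e_l ≤ e_s}` consists of `#{l ; e_l ≤ e_s}`-distinct and `k`-linearly
  independent elements in the `k`-vector space `F^{e_s}(G_1)` for `s = 1, …, N`.»
* Remark 4.1.1.1 (3) (p0086 L31): «Conditions (i) and (ii) imply that, for any regular system of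
  parameters `(y_1, …, y_d)`, the matrix `M_y = [∂_{y_i^{p^e}}(h_l)]` … has the full rank … Therefore, by a
  linear change of variables, we may always come up with a regular system of parameters `(x_1, …, x_d)`
  satisfying the condition in our situation.»
* **Lemma 4.1.2.3 (Supporting Lemma 3)** (p0088 L43–L47): «We have
  `(∑_{l=1}^N R h_l) ∩ 𝔪^r = ∑_{l=1}^N 𝔪^{r−p^{e_l}} h_l` for any `r ∈ ℤ_{≥0}`. (We use the convention that
  `𝔪ⁿ = R` when `n ≤ 0`.)»; p0088 L41: «given a linear combination of `(h_1, …, h_L)`, we can retake the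
  coefficients so that they have the expected multiplicities». Printed proof (p0088 L49 – p0090 L29):
  induction on `(χ, L, r)`, Case 3 via Supporting Lemma 2.

## What is proved here, and how (faithfulness notes)

* `span_inf_maximalIdeal_pow_eq` — **Lemma 4.1.2.3** for ANY regular local ring `R` of exponential
  characteristic `p` (`[ExpChar R p]`; `p = 1` is the characteristic-zero convention of the tree's
  `LeadingGeneratorSystem.lean`), a finite index type `ι` (the printed `l = 1, …, N`), `h : ι → R`,
  `e : ι → ℕ`, with (i) typed as `pow_mem` + `IsPure` of the class `h̄_l ∈ G_{p^{e_l}}` and (ii) as linear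
  independence of the tree's `lgsFamily p h e _ e₀` at every level `e₀` (exactly the fields of
  `IsWeakLGS`; the printed (ii) asks it at the levels `e_s` only — equivalent, and the printed form is
  implied by ours): `Ideal.span (range h) ⊓ 𝔪^r = ⨆ l, 𝔪^(r - p^(e l)) * (h l)`, natural-number
  truncated subtraction realising «`𝔪ⁿ = R` when `n ≤ 0`». The printed `R` (localization at a closed
  point of a smooth `k`-variety, or its completion) is a regular local ring containing `k`, so both printed
  cases are instances. Corollaries: `exists_coeff_mem_pow_of_mem_span_inter_pow` (the «retake the
  coefficients» form), `IsWeakLGS.span_inf_maximalIdeal_pow_eq`, `IsLGS.span_inf_maximalIdeal_pow_eq`.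
* ROUTE (deviates from the printed proof, as allowed for a genuinely shorter road): by
  `exists_rsop_sub_pow_mem` (= Remark 4.1.1.1 (3), proved: Frobenius reflects relations modulo `𝔪`, so the
  pure roots `v̄_l` of the `h̄_l` are linearly independent in `𝔪/𝔪²` and lift into a regular system of
  parameters, tree `exists_extend_to_rsop`) one has `h_l ≡ x_{v l}^{p^{e_l}} mod 𝔪^{p^{e_l}+1}`; the
  initial forms `X_{v l}^{p^{e_l}}` form a regular sequence of the polynomial ring `gr_𝔪(R) = k[X]`
  (Matsumura 17.10, tree `RegularLocalRingsNormal.lean`), and the identity is the classical standard-base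
  filtration property (Valabrega–Valla, Nagoya Math. J. 72 (1978)), proved here directly:
  `exists_repr_of_mem_span_inter_pow` (induction on the number of elements; the coefficient of the new
  element is improved one degree at a time by `exists_sub_sum_mem_pow_succ`, whose heart is the monomial
  colon `mem_span_X_pow_of_X_pow_mul_mem`: `X_j^n B ∈ (X_{v l}^{q_l})_l`, `j ∉ v(S)` ⟹ `B ∈ (X_{v l}^{q_l})_l`).
  The core statements allow arbitrary exponents `q_l` in place of `p^{e_l}`. The generic helper lemmas
  (polynomial / local-ring bookkeeping) are `private` (Literature carries cited statements only).

AI-written; AI review is weaker than expert review.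

## References

* H. Kawanoue, Publ. RIMS 43 (2007) 819–909 = arXiv:math/0607009: Ch. 4 setting (p0085 L17), Setting
  4.1.1 (p0086 L1–L4), Rem. 4.1.1.1 (3) (p0086 L31), Lemma 4.1.2.3 (p0088 L43–L47). [Kawanoue2007]
* H. Matsumura, *Commutative Ring Theory* (1986), Thm. 14.2, Thm. 17.10 (through the tree files
  `RegularSystemOfParameters`, `RegularLocalRingsNormal`, `StrictNormalCrossingsDescent`). [Matsumura1987]
* P. Valabrega, G. Valla, *Form rings and regular sequences*, Nagoya Math. J. 72 (1978) 93–101 (the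
  classical filtration property of a standard base; attribution only).
-/

noncomputable section

namespace Literature.AlgebraicGeometry.Kawanoue2007

open IsLocalRing MvPolynomial
open Literature.AlgebraicGeometry.Resolution
open Literature.RingTheory.HilbertSamuel (gradedPiece gradedPiece.mk)

universe u

/-! ## Polynomial lemmas -/

section Polynomial

variable {σ : Type*} {K : Type*} [CommRing K]

/-- Monomial colon: if `X_j^n · B` lies in the ideal generated by powers `X_{v l}^{q l}` of variables all
different from `X_j`, then so does `B`. [folklore] -/
private theorem mem_span_X_pow_of_X_pow_mul_mem {ι : Type*} (S : Finset ι) (v : ι → σ) (q : ι → ℕ)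
    {j : σ} (hj : ∀ l ∈ S, v l ≠ j) (n : ℕ) {B : MvPolynomial σ K}
    (hB : X j ^ n * B ∈ Ideal.span ((fun l => X (v l) ^ q l) '' (S : Set ι))) :
    B ∈ Ideal.span ((fun l => X (v l) ^ q l) '' (S : Set ι)) := by
  classical
  have hset : ((fun l => X (v l) ^ q l) '' (S : Set ι) : Set (MvPolynomial σ K)) =
      (fun s => monomial s (1 : K)) '' ((fun l => Finsupp.single (v l) (q l)) '' (S : Set ι)) := by
    rw [Set.image_image]
    exact Set.image_congr' fun l => X_pow_eq_monomial
  rw [hset, mem_ideal_span_monomial_image] at hB ⊢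
  intro m hm
  have hm' : m + Finsupp.single j n ∈ (X j ^ n * B).support := by
    rw [mem_support_iff, X_pow_eq_monomial, coeff_monomial_mul']
    rw [if_pos (by simp), one_mul, add_tsub_cancel_right]
    exact mem_support_iff.mp hm
  obtain ⟨si, hsi, hle⟩ := hB _ hm'
  refine ⟨si, hsi, ?_⟩
  obtain ⟨l, hl, rfl⟩ := hsi
  rw [Finsupp.single_le_iff] at hle ⊢
  simpa [Finsupp.single_apply, (hj l hl).symm] using hle

/-- Homogeneous polynomials over the residue field lift to homogeneous polynomials of the same degree.
[folklore] -/
private theorem exists_isHomogeneous_map_residue_eq {R : Type u} [CommRing R] [IsLocalRing R]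
    {n : ℕ} (P : MvPolynomial σ (ResidueField R)) (hP : P.IsHomogeneous n) :
    ∃ D : MvPolynomial σ R, D.IsHomogeneous n ∧ map (residue R) D = P := by
  classical
  choose s hs using fun c : ResidueField R => residue_surjective (R := R) c
  refine ⟨∑ m ∈ P.support, monomial m (s (P.coeff m)), ?_, ?_⟩
  · refine IsHomogeneous.sum _ _ _ fun m hm => ?_
    refine isHomogeneous_monomial _ ?_
    rw [Finsupp.degree_eq_weight_one]
    exact hP (mem_support_iff.mp hm)
  · rw [map_sum]
    simp_rw [map_monomial, hs]
    exact (as_sum P).symm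

end Polynomial

/-! ## The core statement in adapted coordinates -/

section LocalLemmas

variable {R : Type u} [CommRing R] [IsLocalRing R]

/-- Products: `𝔪^a · 𝔪^b ⊆ 𝔪^(a+b)`, element form. [folklore] -/
private theorem mul_mem_pow_add {a b : ℕ} {f g : R} (hf : f ∈ maximalIdeal R ^ a)
    (hg : g ∈ maximalIdeal R ^ b) : f * g ∈ maximalIdeal R ^ (a + b) := by
  rw [pow_add]; exact Ideal.mul_mem_mul hf hg

end LocalLemmas

section Core

variable {R : Type u} [CommRing R] [IsRegularLocalRing R]
variable {d : ℕ} (hd : (maximalIdeal R).spanFinrank = d) (x : Fin d → R)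
  (hx : Ideal.span (Set.range x) = maximalIdeal R)

variable {ι : Type*} (v : ι → Fin d) (q : ι → ℕ) (h : ι → R)

include hx in
/-- The members of the regular system of parameters lie in `𝔪`. [folklore] -/
private theorem rsop_mem (i : Fin d) : x i ∈ maximalIdeal R :=
  hx ▸ Ideal.subset_span ⟨i, rfl⟩

include hx in
/-- An element with initial form `X_{v l}^{q l}` lies in `𝔪^{q l}`. [folklore] -/
private theorem mem_pow_of_sub_X_pow_mem {l : ι}
    (hh : h l - x (v l) ^ q l ∈ maximalIdeal R ^ (q l + 1)) : h l ∈ maximalIdeal R ^ q l := by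
  have h1 : x (v l) ^ q l ∈ maximalIdeal R ^ q l := Ideal.pow_mem_pow (rsop_mem x hx (v l)) _
  have h2 : h l - x (v l) ^ q l ∈ maximalIdeal R ^ q l :=
    Ideal.pow_le_pow_right (Nat.le_succ _) hh
  simpa using add_mem h2 h1

include hd hx in
/-- **Graded step.** In adapted coordinates (`h_l ≡ x_{v l}^{q_l} mod 𝔪^{q_l+1}`, `v` injective,
`a ∉ S`): if `β ∈ 𝔪^{a₀}`, `γ_l ∈ 𝔪^{a₀+q_a-q_l}` and `β h_a + Σ_{l∈S} γ_l h_l ∈ 𝔪^{a₀+q_a+1}`, then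
`β ≡ Σ_{l∈S} δ_l h_l mod 𝔪^{a₀+1}` for some `δ_l ∈ 𝔪^{a₀-q_l}` — the initial form of `β` lies in the
monomial ideal `(X_{v l}^{q_l} : l ∈ S)` because `X_{v a}^{q_a}` is a non-zero-divisor modulo it.
[folklore] -/
private theorem exists_sub_sum_mem_pow_succ (hv : Function.Injective v)
    (hh : ∀ l, h l - x (v l) ^ q l ∈ maximalIdeal R ^ (q l + 1))
    {S : Finset ι} {a : ι} (ha : a ∉ S) (a₀ : ℕ)
    {β : R} (hβ : β ∈ maximalIdeal R ^ a₀) {γ : ι → R}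
    (hγ : ∀ l ∈ S, γ l ∈ maximalIdeal R ^ (a₀ + q a - q l))
    (hsum : β * h a + ∑ l ∈ S, γ l * h l ∈ maximalIdeal R ^ (a₀ + q a + 1)) :
    ∃ δ : ι → R, (∀ l ∈ S, δ l ∈ maximalIdeal R ^ (a₀ - q l)) ∧
      β - ∑ l ∈ S, δ l * h l ∈ maximalIdeal R ^ (a₀ + 1) := by
  classical
  -- Step 1: forms representing `β` and the `γ_l`
  obtain ⟨B, hB, hBβ⟩ := exists_isHomogeneous_eval_eq_of_mem_pow x hx hβ
  have hC : ∀ l, ∃ C : MvPolynomial (Fin d) R,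
      C.IsHomogeneous (a₀ + q a - q l) ∧ (l ∈ S → eval x C = γ l) := by
    intro l
    by_cases hl : l ∈ S
    · obtain ⟨C, hC, hCe⟩ := exists_isHomogeneous_eval_eq_of_mem_pow x hx (hγ l hl)
      exact ⟨C, hC, fun _ => hCe⟩
    · exact ⟨0, isHomogeneous_zero _ _ _, fun h' => absurd h' hl⟩
  choose C hC hCγ using hC
  -- Step 2: the form `P = X_{v a}^{q a} B + Σ_{l ∈ T} X_{v l}^{q l} C_l` of degree `a₀ + q a`
  set T := S.filter (fun l => q l ≤ a₀ + q a) with hT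
  have hTS : ∀ l ∈ T, l ∈ S := fun l hl => (Finset.mem_filter.mp hl).1
  have hTq : ∀ l ∈ T, q l ≤ a₀ + q a := fun l hl => (Finset.mem_filter.mp hl).2
  set P : MvPolynomial (Fin d) R := X (v a) ^ q a * B + ∑ l ∈ T, X (v l) ^ q l * C l with hP
  have hPhom : P.IsHomogeneous (a₀ + q a) := by
    refine IsHomogeneous.add ?_ (IsHomogeneous.sum _ _ _ fun l hl => ?_)
    · have := (isHomogeneous_X_pow (R := R) (v a) (q a)).mul hB
      rwa [add_comm] at this
    · have := (isHomogeneous_X_pow (R := R) (v l) (q l)).mul (hC l)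
      rwa [Nat.add_sub_cancel' (hTq l hl)] at this
  -- Step 3: `P(x) ∈ 𝔪^{a₀ + q a + 1}`
  have hPeval : eval x P ∈ maximalIdeal R ^ (a₀ + q a + 1) := by
    have e1 : eval x P = β * x (v a) ^ q a + ∑ l ∈ T, γ l * x (v l) ^ q l := by
      simp only [hP, map_add, map_mul, map_pow, eval_X, map_sum, hBβ]
      rw [mul_comm]
      refine congrArg _ (Finset.sum_congr rfl fun l hl => ?_)
      rw [hCγ l (hTS l hl), mul_comm]
    have e2 : eval x P = (β * h a + ∑ l ∈ S, γ l * h l) -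
        (β * (h a - x (v a) ^ q a) + ∑ l ∈ T, γ l * (h l - x (v l) ^ q l) +
          ∑ l ∈ S.filter (fun l => ¬ q l ≤ a₀ + q a), γ l * h l) := by
      rw [e1, ← Finset.sum_filter_add_sum_filter_not S (fun l => q l ≤ a₀ + q a)]
      simp only [mul_sub, Finset.sum_sub_distrib]
      ring
    rw [e2]
    refine sub_mem hsum (add_mem (add_mem ?_ (sum_mem fun l hl => ?_)) (sum_mem fun l hl => ?_))
    · have := mul_mem_pow_add (a := a₀) (b := q a + 1) hβ (hh a)
      rwa [show a₀ + (q a + 1) = a₀ + q a + 1 by omega] at this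
    · have := mul_mem_pow_add (a := a₀ + q a - q l) (b := q l + 1) (hγ l (hTS l hl)) (hh l)
      rwa [show a₀ + q a - q l + (q l + 1) = a₀ + q a + 1 by have := hTq l hl; omega] at this
    · obtain ⟨hlS, hlq⟩ := Finset.mem_filter.mp hl
      refine Ideal.pow_le_pow_right (show a₀ + q a + 1 ≤ q l by omega) ?_
      exact Ideal.mul_mem_left _ _ (mem_pow_of_sub_X_pow_mem x hx v q h (hh l))
  -- Step 4: reduce mod `𝔪`: `X_{v a}^{q a} B̄ ∈ (X_{v l}^{q l} : l ∈ S)` in `k[X]`, hence `B̄` too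
  have hPres : map (residue R) P = 0 := map_residue_eq_zero_of_eval_mem_pow_succ hd x hx hPhom hPeval
  set k := ResidueField R
  set F : ι → MvPolynomial (Fin d) k := fun l => X (v l) ^ q l with hF
  have hBM : X (v a) ^ q a * map (residue R) B ∈ Ideal.span (F '' (S : Set ι)) := by
    have e3 : X (v a) ^ q a * map (residue R) B =
        -(∑ l ∈ T, X (v l) ^ q l * map (residue R) (C l)) := by
      have := hPres
      simp only [hP, map_add, map_mul, map_pow, map_X, map_sum] at this
      linear_combination this
    rw [e3]
    exact neg_mem (sum_mem fun l hl =>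
      Ideal.mul_mem_right _ _ (Ideal.subset_span ⟨l, Finset.mem_coe.mpr (hTS l hl), rfl⟩))
  have hBM' : map (residue R) B ∈ Ideal.span (F '' (S : Set ι)) :=
    mem_span_X_pow_of_X_pow_mul_mem S v q (j := v a)
      (fun l hl heq => ha (hv heq ▸ hl)) (q a) hBM
  -- Step 5: `B̄ = Σ_{l∈S} X_{v l}^{q l} E_l`, and its degree-`a₀` component
  rw [Set.image_eq_range, Ideal.mem_span_range_iff_exists_fun] at hBM'
  obtain ⟨c, hc⟩ := hBM'
  set E : ι → MvPolynomial (Fin d) k := fun l => if hl : l ∈ S then c ⟨l, hl⟩ else 0 with hE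
  have hcE : ∑ l ∈ S, X (v l) ^ q l * E l = map (residue R) B := by
    rw [← hc, ← Finset.sum_coe_sort S]
    refine Finset.sum_congr rfl fun l _ => ?_
    rw [hE]; simp only [Finset.coe_mem, dif_pos, Subtype.coe_eta]; exact mul_comm _ _
  set Ebar : ι → MvPolynomial (Fin d) k :=
    fun l => if q l ≤ a₀ then homogeneousComponent (a₀ - q l) (E l) else 0 with hEbar
  have hEbar_hom : ∀ l, (Ebar l).IsHomogeneous (a₀ - q l) := by
    intro l; simp only [hEbar]
    split_ifs
    · exact homogeneousComponent_isHomogeneous _ _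
    · exact isHomogeneous_zero _ _ _
  have hcomp : ∑ l ∈ S, X (v l) ^ q l * Ebar l = map (residue R) B := by
    have hBres : (map (residue R) B).IsHomogeneous a₀ := hB.map _
    have hBcomp : homogeneousComponent a₀ (map (residue R) B) = map (residue R) B := by
      rw [homogeneousComponent_of_mem hBres, if_pos rfl]
    rw [← hBcomp, ← hcE, map_sum]
    refine Finset.sum_congr rfl fun l _ => ?_
    simp only [hEbar]
    split_ifs with hql
    · rw [← homogeneousComponent_mul_of_isHomogeneous_left (isHomogeneous_X_pow (v l) (q l)),
        Nat.add_sub_cancel' hql]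
    · rw [mul_zero, homogeneousComponent_mul_eq_zero_of_lt (isHomogeneous_X_pow (v l) (q l)) (by omega)]
  -- Step 6: lift the components and evaluate
  have hD : ∀ l, ∃ D : MvPolynomial (Fin d) R, D.IsHomogeneous (a₀ - q l) ∧ map (residue R) D = Ebar l :=
    fun l => exists_isHomogeneous_map_residue_eq (Ebar l) (hEbar_hom l)
  choose D hDhom hDres using hD
  set T₀ := S.filter (fun l => q l ≤ a₀) with hT₀
  have hT₀q : ∀ l ∈ T₀, q l ≤ a₀ := fun l hl => (Finset.mem_filter.mp hl).2
  refine ⟨fun l => if q l ≤ a₀ then eval x (D l) else 0, fun l _ => ?_, ?_⟩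
  · beta_reduce
    split_ifs
    · exact hx ▸ eval_mem_span_pow x (hDhom l)
    · exact zero_mem _
  · -- `β - Σ δ_l h_l = Q(x) - Σ_{T₀} δ_l (h_l - x^{q_l})` with `Q̄ = 0`
    set Q : MvPolynomial (Fin d) R := B - ∑ l ∈ T₀, X (v l) ^ q l * D l with hQ
    have hQhom : Q.IsHomogeneous a₀ := by
      refine hB.sub (IsHomogeneous.sum _ _ _ fun l hl => ?_)
      have := (isHomogeneous_X_pow (R := R) (v l) (q l)).mul (hDhom l)
      rwa [Nat.add_sub_cancel' (hT₀q l hl)] at this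
    have hQres : map (residue R) Q = 0 := by
      simp only [hQ, map_sub, map_sum, map_mul, map_pow, map_X, hDres]
      rw [← hcomp, ← Finset.sum_filter_add_sum_filter_not S (fun l => q l ≤ a₀), sub_eq_zero,
        Finset.sum_eq_zero (s := S.filter fun l => ¬ q l ≤ a₀) (fun l hl => by
          simp only [hEbar, if_neg (Finset.mem_filter.mp hl).2, mul_zero]), add_zero]
    have hQeval : eval x Q ∈ maximalIdeal R ^ (a₀ + 1) :=
      eval_mem_pow_succ_of_map_residue_eq_zero x hx hQhom hQres
    have e4 : β - ∑ l ∈ S, (if q l ≤ a₀ then eval x (D l) else 0) * h l =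
        eval x Q - ∑ l ∈ T₀, eval x (D l) * (h l - x (v l) ^ q l) := by
      rw [← Finset.sum_filter_add_sum_filter_not S (fun l => q l ≤ a₀),
        Finset.sum_eq_zero (s := S.filter fun l => ¬ q l ≤ a₀) (fun l hl => by
          rw [if_neg (Finset.mem_filter.mp hl).2, zero_mul]), add_zero,
        Finset.sum_congr rfl (fun l hl => by rw [if_pos (hT₀q l hl)])]
      simp only [hQ, map_sub, map_sum, map_mul, map_pow, eval_X, hBβ, mul_sub,
        Finset.sum_sub_distrib]
      have : ∑ l ∈ T₀, x (v l) ^ q l * eval x (D l) = ∑ l ∈ T₀, eval x (D l) * x (v l) ^ q l :=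
        Finset.sum_congr rfl fun l _ => mul_comm _ _
      rw [this]
      ring
    rw [e4]
    refine sub_mem hQeval (sum_mem fun l hl => ?_)
    have := mul_mem_pow_add (a := a₀ - q l) (b := q l + 1) (hx ▸ eval_mem_span_pow x (hDhom l)) (hh l)
    rwa [show a₀ - q l + (q l + 1) = a₀ + 1 by have := hT₀q l hl; omega] at this

include hd hx in
/-- **Core form of Supporting Lemma 3, in adapted coordinates.** Let `x` be a regular system of parameters
of the regular local ring `R`, `v : ι → Fin d` injective, and `h_l ≡ x_{v l}^{q_l} mod 𝔪^{q_l+1}`. Then every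
`g ∈ (h_l : l ∈ S) ∩ 𝔪^r` can be written `g = Σ_{l∈S} γ_l h_l` with `γ_l ∈ 𝔪^{r-q_l}` (`𝔪^n = R` for
`n ≤ 0`). Induction on `S`; the step raises the order of the last coefficient one unit at a time with
`exists_sub_sum_mem_pow_succ`. [cite: Kawanoue2007, Lemma 4.1.2.3] -/
theorem exists_repr_of_mem_span_inter_pow (hv : Function.Injective v)
    (hh : ∀ l, h l - x (v l) ^ q l ∈ maximalIdeal R ^ (q l + 1)) (S : Finset ι) :
    ∀ (r : ℕ) (g : R), g ∈ maximalIdeal R ^ r → g ∈ Ideal.span (h '' (S : Set ι)) →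
      ∃ γ : ι → R, (∀ l ∈ S, γ l ∈ maximalIdeal R ^ (r - q l)) ∧ g = ∑ l ∈ S, γ l * h l := by
  classical
  induction S using Finset.induction_on with
  | empty =>
    intro r g _ hg
    rw [Finset.coe_empty, Set.image_empty, Ideal.span_empty, Ideal.mem_bot] at hg
    exact ⟨0, fun l hl => by simp at hl, by simp [hg]⟩
  | @insert a S ha IH =>
    intro r g hgr hg
    rw [Finset.coe_insert, Set.image_insert_eq, Ideal.mem_span_insert] at hg
    obtain ⟨β, z, hz, rfl⟩ := hg
    have hha : h a ∈ maximalIdeal R ^ q a := mem_pow_of_sub_X_pow_mem x hx v q h (hh a)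
    -- the lifting loop: raise the order of the coefficient of `h a` up to `r - q a`
    have loop : ∀ (t a₀ : ℕ) (β' : R), β' ∈ maximalIdeal R ^ a₀ →
        β * h a + z - β' * h a ∈ Ideal.span (h '' (S : Set ι)) → a₀ + t = r - q a →
        ∃ β'' : R, β'' ∈ maximalIdeal R ^ (r - q a) ∧
          β * h a + z - β'' * h a ∈ Ideal.span (h '' (S : Set ι)) := by
      intro t
      induction t with
      | zero =>
        intro a₀ β' h1 h2 h3
        exact ⟨β', by rw [← h3]; simpa using h1, h2⟩
      | succ t iht =>
        intro a₀ β' h1 h2 h3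
        have hg' : β * h a + z - β' * h a ∈ maximalIdeal R ^ (a₀ + q a) :=
          sub_mem (Ideal.pow_le_pow_right (by omega) hgr) (mul_mem_pow_add h1 hha)
        obtain ⟨γ, hγ, hγsum⟩ := IH (a₀ + q a) _ hg' h2
        have hsum : β' * h a + ∑ l ∈ S, γ l * h l ∈ maximalIdeal R ^ (a₀ + q a + 1) := by
          rw [← hγsum, add_sub_cancel]
          exact Ideal.pow_le_pow_right (by omega) hgr
        obtain ⟨δ, -, hβ₁⟩ := exists_sub_sum_mem_pow_succ hd x hx v q h hv hh ha a₀ h1 hγ hsum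
        refine iht (a₀ + 1) (β' - ∑ l ∈ S, δ l * h l) hβ₁ ?_ (by omega)
        have e : β * h a + z - (β' - ∑ l ∈ S, δ l * h l) * h a =
            (β * h a + z - β' * h a) + h a * ∑ l ∈ S, δ l * h l := by ring
        rw [e]
        exact add_mem h2 (Ideal.mul_mem_left _ _ (sum_mem fun l hl =>
          Ideal.mul_mem_left _ _ (Ideal.subset_span ⟨l, Finset.mem_coe.mpr hl, rfl⟩)))
    obtain ⟨β', hβ', hz'⟩ := loop (r - q a) 0 β (by simp) (by simpa using hz) (by simp)
    have hgr' : β * h a + z - β' * h a ∈ maximalIdeal R ^ r :=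
      sub_mem hgr (Ideal.pow_le_pow_right (by omega) (mul_mem_pow_add hβ' hha))
    obtain ⟨γ, hγ, hγsum⟩ := IH r _ hgr' hz'
    refine ⟨Function.update γ a β', fun l hl => ?_, ?_⟩
    · rcases Finset.mem_insert.mp hl with rfl | hl'
      · rw [Function.update_self]; exact hβ'
      · have hne : l ≠ a := by rintro rfl; exact ha hl'
        rw [Function.update_of_ne hne]; exact hγ l hl'
    · have hS : ∑ l ∈ S, Function.update γ a β' l * h l = ∑ l ∈ S, γ l * h l :=
        Finset.sum_congr rfl fun l hl => by
          have hne : l ≠ a := by rintro rfl; exact ha hl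
          rw [Function.update_of_ne hne]
      rw [Finset.sum_insert ha, Function.update_self, hS, ← hγsum]
      ring

include hd hx in
/-- **Core form, ideal version**: `(h_l : l ∈ S) ∩ 𝔪^r = Σ_{l∈S} 𝔪^{r-q_l} h_l` in adapted coordinates.
[cite: Kawanoue2007, Lemma 4.1.2.3] -/
theorem span_inf_pow_eq_iSup_of_sub_X_pow_mem (hv : Function.Injective v)
    (hh : ∀ l, h l - x (v l) ^ q l ∈ maximalIdeal R ^ (q l + 1)) (S : Finset ι) (r : ℕ) :
    Ideal.span (h '' (S : Set ι)) ⊓ maximalIdeal R ^ r =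
      ⨆ l ∈ S, maximalIdeal R ^ (r - q l) * Ideal.span {h l} := by
  classical
  refine le_antisymm ?_ ?_
  · rintro g ⟨hg, hgr⟩
    obtain ⟨γ, hγ, rfl⟩ := exists_repr_of_mem_span_inter_pow hd x hx v q h hv hh S r g hgr hg
    refine Ideal.sum_mem _ fun l hl => ?_
    refine Ideal.mem_iSup_of_mem l (Ideal.mem_iSup_of_mem hl ?_)
    exact Ideal.mul_mem_mul (hγ l hl) (Ideal.mem_span_singleton_self _)
  · refine iSup₂_le fun l hl => ?_
    rw [Ideal.mul_le]
    intro f hf g hg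
    obtain ⟨c, rfl⟩ := Ideal.mem_span_singleton'.mp hg
    refine ⟨?_, ?_⟩
    · rw [← mul_assoc]
      exact Ideal.mul_mem_left _ _ (Ideal.subset_span ⟨l, Finset.mem_coe.mpr hl, rfl⟩)
    · have hha : h l ∈ maximalIdeal R ^ q l := mem_pow_of_sub_X_pow_mem x hx v q h (hh l)
      have := mul_mem_pow_add hf (Ideal.mul_mem_left _ c hha)
      exact Ideal.pow_le_pow_right (by omega) this

end Core

/-! ## Graded-piece lemmas (any local ring) -/

section GradedPiece

variable {R : Type u} [CommRing R] [IsLocalRing R]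

/-- `a ≡ b mod 𝔪ⁿ⁺¹` with `b ∈ 𝔪ⁿ` implies `aᵐ ≡ bᵐ mod 𝔪^{nm+1}`. [folklore] -/
private theorem pow_sub_pow_mem_pow_succ {a b : R} {n : ℕ} (hb : b ∈ maximalIdeal R ^ n)
    (hab : a - b ∈ maximalIdeal R ^ (n + 1)) (m : ℕ) :
    a ^ m - b ^ m ∈ maximalIdeal R ^ (n * m + 1) := by
  have ha : a ∈ maximalIdeal R ^ n := by
    simpa using add_mem (Ideal.pow_le_pow_right (Nat.le_succ n) hab) hb
  induction m with
  | zero => simp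
  | succ m ih =>
    have e : a ^ (m + 1) - b ^ (m + 1) = a * (a ^ m - b ^ m) + (a - b) * b ^ m := by ring
    rw [e]
    refine add_mem ?_ ?_
    · have := Ideal.mul_mem_mul ha ih
      rw [← pow_add] at this
      convert this using 2
      ring
    · have := Ideal.mul_mem_mul hab (Ideal.pow_mem_pow hb m)
      rw [← pow_mul, ← pow_add] at this
      convert this using 2
      ring

/-- Linear independence of classes in `G_n = 𝔪ⁿ/𝔪ⁿ⁺¹`, read on representatives: a relation
`∑ r_i f_i ∈ 𝔪ⁿ⁺¹` forces all `r_i ∈ 𝔪`. [folklore] -/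
private theorem forall_mem_maximalIdeal_of_linearIndependent_mk {ι : Type*} (n : ℕ) (f : ι → R)
    (hf : ∀ i, f i ∈ maximalIdeal R ^ n)
    (H : LinearIndependent (ResidueField R)
      (fun i => gradedPiece.mk (maximalIdeal R) n ⟨f i, hf i⟩))
    (s : Finset ι) (r : ι → R) (hsum : (∑ i ∈ s, r i * f i) ∈ maximalIdeal R ^ (n + 1)) :
    ∀ i ∈ s, r i ∈ maximalIdeal R := by
  intro i hi
  rw [linearIndependent_iff'] at H
  have hcoe : ((∑ i ∈ s, r i • (⟨f i, hf i⟩ : ↥(maximalIdeal R ^ n)) : ↥(maximalIdeal R ^ n)) : R) =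
      ∑ i ∈ s, r i * f i := by
    simp
  have h0 : ∑ i ∈ s, residue R (r i) • gradedPiece.mk (maximalIdeal R) n ⟨f i, hf i⟩ = 0 := by
    have e : ∑ i ∈ s, residue R (r i) • gradedPiece.mk (maximalIdeal R) n ⟨f i, hf i⟩ =
        gradedPiece.mk (maximalIdeal R) n
          (∑ i ∈ s, r i • (⟨f i, hf i⟩ : ↥(maximalIdeal R ^ n))) := by
      rw [map_sum]
      refine Finset.sum_congr rfl fun i _ => ?_
      rw [map_smul]
      exact algebraMap_smul (ResidueField R) (r i) _
    rw [e, gradedPiece.mk_eq_zero_iff, hcoe]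
    exact hsum
  exact (residue_eq_zero_iff _).mp (H s _ h0 i hi)

/-- Relations are reflected by `p^j`-th powers in exponential characteristic `p`: if every relation
`∑ r_i f_i^{p^j} ∈ 𝔪^{n p^j + 1}` forces `r_i ∈ 𝔪`, then so does every relation `∑ r_i f_i ∈ 𝔪ⁿ⁺¹`
(`(∑ r_i f_i)^{p^j} = ∑ r_i^{p^j} f_i^{p^j}` and `𝔪` is prime). [folklore] -/
private theorem forall_mem_maximalIdeal_of_pow (p : ℕ) [ExpChar R p] {ι : Type*} (n j : ℕ) (f : ι → R)
    (H : ∀ (s : Finset ι) (r : ι → R), (∑ i ∈ s, r i * (f i) ^ p ^ j) ∈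
      maximalIdeal R ^ (n * p ^ j + 1) → ∀ i ∈ s, r i ∈ maximalIdeal R)
    (s : Finset ι) (r : ι → R) (hsum : (∑ i ∈ s, r i * f i) ∈ maximalIdeal R ^ (n + 1)) :
    ∀ i ∈ s, r i ∈ maximalIdeal R := by
  intro i hi
  have h1 : (∑ i ∈ s, r i * f i) ^ p ^ j = ∑ i ∈ s, (r i) ^ p ^ j * (f i) ^ p ^ j := by
    rw [sum_pow_char_pow p j]
    exact Finset.sum_congr rfl fun i _ => mul_pow _ _ _
  have h2 : (∑ i ∈ s, (r i) ^ p ^ j * (f i) ^ p ^ j) ∈ maximalIdeal R ^ (n * p ^ j + 1) := by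
    rw [← h1]
    have h := Ideal.pow_mem_pow hsum (p ^ j)
    rw [← pow_mul] at h
    refine Ideal.pow_le_pow_right ?_ h
    have : 1 ≤ p ^ j := Nat.one_le_pow _ _ (expChar_pos R p)
    nlinarith
  have h3 := H s (fun i => (r i) ^ p ^ j) h2 i hi
  exact (Ideal.IsPrime.pow_mem_iff_mem inferInstance _ (pow_pos (expChar_pos R p) j)).mp h3

end GradedPiece

/-! ## Setting 4.1.1: adapted regular system of parameters, and Lemma 4.1.2.3 -/

section Setting

variable {R : Type u} [CommRing R] [IsRegularLocalRing R] (p : ℕ) [ExpChar R p]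
variable {ι : Type*} [Finite ι] (h : ι → R) (e : ι → ℕ)

/-- **Adapted coordinates for Setting 4.1.1.** If `h_l ∈ 𝔪^{p^{e_l}}` has PURE initial form
(`h̄_l = v̄_l^{p^{e_l}}`, `v̄_l ∈ G_1`) and the families `{h̄_l^{p^{e-e_l}} ; e_l ≤ e}` are linearly
independent (conditions (i), (ii)), then there is a regular system of parameters `x` and an injective
relabelling `v` with `h_l ≡ x_{v l}^{p^{e_l}} mod 𝔪^{p^{e_l}+1}`: the `v̄_l` are linearly independent
in `𝔪/𝔪²` (Frobenius reflects relations; Remark 4.1.1.1 (3): «by a linear change of variables, we may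
always come up with a regular system of parameters `(x_1, …, x_d)` satisfying the condition»), so their
lifts extend to a minimal basis of `𝔪`. [cite: Kawanoue2007, Remark 4.1.1.1 (3)] -/
theorem exists_rsop_sub_pow_mem
    (pow_mem : ∀ l, h l ∈ maximalIdeal R ^ p ^ e l)
    (pure : ∀ l, IsPure (p ^ e l) (gradedPiece.mk (maximalIdeal R) (p ^ e l) ⟨h l, pow_mem l⟩))
    (li : ∀ e₀, LinearIndependent (ResidueField R) (lgsFamily p h e pow_mem e₀)) :
    ∃ (d : ℕ) (x : Fin d → R) (v : ι → Fin d), (maximalIdeal R).spanFinrank = d ∧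
      Ideal.span (Set.range x) = maximalIdeal R ∧ Function.Injective v ∧
      ∀ l, h l - x (v l) ^ p ^ e l ∈ maximalIdeal R ^ (p ^ e l + 1) := by
  classical
  -- (a) purity: `h_l ≡ w_l^{p^{e_l}}`
  choose w hw hwh using pure
  have hsub : ∀ l, h l - w l ^ p ^ e l ∈ maximalIdeal R ^ (p ^ e l + 1) := by
    intro l
    have h1 := hwh l
    rw [← sub_eq_zero, ← map_sub, gradedPiece.mk_eq_zero_iff] at h1
    have h2 : w l ^ p ^ e l - h l ∈ maximalIdeal R ^ (p ^ e l + 1) := by simpa using h1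
    simpa using neg_mem h2
  -- (b) independence of the `w_l` modulo `𝔪²`
  haveI := Fintype.ofFinite ι
  set e₀ := Finset.univ.sup e with he₀
  have hle : ∀ l, e l ≤ e₀ := fun l => Finset.le_sup (Finset.mem_univ l)
  have hwpow : ∀ l, w l ^ p ^ e₀ ∈ maximalIdeal R ^ p ^ e₀ := fun l => Ideal.pow_mem_pow (hw l) _
  have hfam : (fun l : ι => gradedPiece.mk (maximalIdeal R) (p ^ e₀) ⟨w l ^ p ^ e₀, hwpow l⟩) =
      (lgsFamily p h e pow_mem e₀) ∘ fun l => ⟨l, hle l⟩ := by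
    funext l
    simp only [Function.comp_apply, lgsFamily]
    rw [← sub_eq_zero, ← map_sub, gradedPiece.mk_eq_zero_iff]
    have h1 := pow_sub_pow_mem_pow_succ (Ideal.pow_mem_pow (hw l) (p ^ e l)) (hsub l) (p ^ (e₀ - e l))
    rw [← pow_mul, ← pow_add, Nat.add_sub_cancel' (hle l)] at h1
    simpa using neg_mem h1
  have hli : LinearIndependent (ResidueField R)
      (fun l : ι => gradedPiece.mk (maximalIdeal R) (p ^ e₀) ⟨w l ^ p ^ e₀, hwpow l⟩) := by
    rw [hfam]
    exact (li e₀).comp _ fun l₁ l₂ hl => by simpa using hl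
  have hrel : ∀ (s : Finset ι) (r : ι → R), ∑ i ∈ s, r i * w i ∈ maximalIdeal R ^ (1 + 1) →
      ∀ i ∈ s, r i ∈ maximalIdeal R := by
    refine forall_mem_maximalIdeal_of_pow p 1 e₀ w fun s r hs => ?_
    refine forall_mem_maximalIdeal_of_linearIndependent_mk (p ^ e₀) (fun l => w l ^ p ^ e₀)
      hwpow hli s r ?_
    simpa using hs
  -- (c) extend the `w_l` to a regular system of parameters
  set n := Fintype.card ι with hn
  set eqv := Fintype.equivFin ι with heqv
  set f : Fin n → R := fun i => w (eqv.symm i) with hf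
  have hfm : ∀ i, f i ∈ maximalIdeal R := fun i => hw _
  have hind : ∀ c : Fin n → R, ∑ i, c i * f i ∈ maximalIdeal R ^ 2 → ∀ i, c i ∈ maximalIdeal R := by
    intro c hc i
    have e1 : ∑ i, c i * f i = ∑ l, c (eqv l) * w l := by
      rw [← eqv.sum_comp]
      simp [hf]
    have hc' : ∑ l ∈ Finset.univ, c (eqv l) * w l ∈ maximalIdeal R ^ (1 + 1) := by
      rw [← e1]; exact hc
    simpa using hrel Finset.univ (fun l => c (eqv l)) hc' (eqv.symm i) (Finset.mem_univ _)
  obtain ⟨e', y, hdim, hspan⟩ := exists_extend_to_rsop f hfm hind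
  have hpart : IsRsopPart f := ⟨inferInstance, e', y, hdim, hspan⟩
  obtain ⟨e'', x, hd, hx, hxf⟩ := hpart.exists_rsop
  refine ⟨n + e'', x, fun l => Fin.castAdd e'' (eqv l), hd, hx,
    (Fin.castAdd_injective _ _).comp eqv.injective, fun l => ?_⟩
  have : x (Fin.castAdd e'' (eqv l)) = w l := by rw [hxf]; simp [hf]
  rw [this]
  exact hsub l

/-- **Kawanoue 2007, Lemma 4.1.2.3 (Supporting Lemma 3)** — PROVED [arXiv chunk p0088 L43–L47:
«We have `(∑_{l=1}^N R h_l) ∩ 𝔪^r = ∑_{l=1}^N 𝔪^{r−p^{e_l}} h_l` for any `r ∈ ℤ_{≥0}`. (We use the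
convention that `𝔪ⁿ = R` when `n ≤ 0`.)»], in Setting 4.1.1 [p0086 L1–L6: `ℋ = {h_1, …, h_N} ⊂ R`,
`0 ≤ e_1 ≤ ⋯ ≤ e_N`, (i) `h_l ∈ 𝔪^{p^{e_l}}` and `h̄_l ∈ F^{e_l}(G_1)`, (ii) `{h̄_l^{p^{e_s−e_l}} ; e_l ≤ e_s}`
distinct and `k`-linearly independent]. Typed over ANY regular local ring `R` of exponential
characteristic `p` (the printed `R` is the localization at a closed point of a smooth variety over
`k = k̄`, or its completion — both regular), `ι` a finite index type, (i) as `pow_mem` + `pure`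
(`IsPure`), (ii) as linear independence of `lgsFamily` at every level (as in `IsWeakLGS`; in print at the
levels `e_s`, equivalent), truncated subtraction `r - p^{e_l}` realising the printed convention. The
printed proof is an induction on `(χ, L, r)` through Supporting Lemmas 1–2 (differential operators); this
proof takes the classical road instead: in adapted coordinates the initial forms are the regular sequence
`X_{v l}^{p^{e_l}}` of `gr_𝔪(R) = k[X]`, and the filtration identity follows by lifting coefficients degree
by degree (`exists_repr_of_mem_span_inter_pow`). [cite: Kawanoue2007, Lemma 4.1.2.3] -/
theorem span_inf_maximalIdeal_pow_eq
    (pow_mem : ∀ l, h l ∈ maximalIdeal R ^ p ^ e l)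
    (pure : ∀ l, IsPure (p ^ e l) (gradedPiece.mk (maximalIdeal R) (p ^ e l) ⟨h l, pow_mem l⟩))
    (li : ∀ e₀, LinearIndependent (ResidueField R) (lgsFamily p h e pow_mem e₀)) (r : ℕ) :
    Ideal.span (Set.range h) ⊓ maximalIdeal R ^ r =
      ⨆ l, maximalIdeal R ^ (r - p ^ e l) * Ideal.span {h l} := by
  classical
  haveI := Fintype.ofFinite ι
  obtain ⟨d, x, v, hd, hx, hv, hh⟩ := exists_rsop_sub_pow_mem p h e pow_mem pure li
  have := span_inf_pow_eq_iSup_of_sub_X_pow_mem hd x hx v (fun l => p ^ e l) h hv hh Finset.univ r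
  rw [Finset.coe_univ, Set.image_univ] at this
  rw [this]
  exact iSup_congr fun l => iSup_pos (Finset.mem_univ l)

/-- **Lemma 4.1.2.3, representation form**: every `g ∈ (∑ R h_l) ∩ 𝔪^r` is `∑ γ_l h_l` with
`ord(γ_l) ≥ r − p^{e_l}` («we can retake the coefficients so that they have the expected multiplicities»,
p0088 L40–L41). [cite: Kawanoue2007, Lemma 4.1.2.3] -/
theorem exists_coeff_mem_pow_of_mem_span_inter_pow [Fintype ι]
    (pow_mem : ∀ l, h l ∈ maximalIdeal R ^ p ^ e l)
    (pure : ∀ l, IsPure (p ^ e l) (gradedPiece.mk (maximalIdeal R) (p ^ e l) ⟨h l, pow_mem l⟩))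
    (li : ∀ e₀, LinearIndependent (ResidueField R) (lgsFamily p h e pow_mem e₀))
    {r : ℕ} {g : R} (hgr : g ∈ maximalIdeal R ^ r) (hg : g ∈ Ideal.span (Set.range h)) :
    ∃ γ : ι → R, (∀ l, γ l ∈ maximalIdeal R ^ (r - p ^ e l)) ∧ g = ∑ l, γ l * h l := by
  classical
  obtain ⟨d, x, v, hd, hx, hv, hh⟩ := exists_rsop_sub_pow_mem p h e pow_mem pure li
  obtain ⟨γ, hγ, hsum⟩ := exists_repr_of_mem_span_inter_pow hd x hx v (fun l => p ^ e l) h hv hh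
    Finset.univ r g hgr (by rwa [Finset.coe_univ, Set.image_univ])
  exact ⟨γ, fun l => hγ l (Finset.mem_univ l), hsum⟩

/-- **Lemma 4.1.2.3 for a (weak) leading generator system** (Remark 3.1.3.3 (2) / Def. 3.1.3.1: the
tree's `IsWeakLGS`, which is how Setting 4.1.1 (i)(ii) + Setting 4.1.3 (iii) enter Chapter 4).
[cite: Kawanoue2007, Lemma 4.1.2.3] -/
theorem IsWeakLGS.span_inf_maximalIdeal_pow_eq {𝕀 : IdealisticFiltration R} (H : IsWeakLGS p 𝕀 h e)
    (r : ℕ) :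
    Ideal.span (Set.range h) ⊓ maximalIdeal R ^ r =
      ⨆ l, maximalIdeal R ^ (r - p ^ e l) * Ideal.span {h l} :=
  Kawanoue2007.span_inf_maximalIdeal_pow_eq p h e H.pow_mem (fun l => (H.pure l).2)
    H.linearIndependent r

/-- The same for a leading generator system (Def. 3.1.3.1). [cite: Kawanoue2007, Lemma 4.1.2.3] -/
theorem IsLGS.span_inf_maximalIdeal_pow_eq {𝕀 : IdealisticFiltration R} (H : IsLGS p 𝕀 h e)
    (r : ℕ) :
    Ideal.span (Set.range h) ⊓ maximalIdeal R ^ r =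
      ⨆ l, maximalIdeal R ^ (r - p ^ e l) * Ideal.span {h l} :=
  IsWeakLGS.span_inf_maximalIdeal_pow_eq p h e H.isWeakLGS r

end Setting

end Literature.AlgebraicGeometry.Kawanoue2007

end
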